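import Mathlib.Tactic.Linarith
import Summits.CriticalPhenomena.PercolationContinuityZ3.Theorems.PercNearOneGluingNoHeavyLowerTailSahiCTCHarrisBlock
import HarnessLib

/-!
# `NoHeavyLowerTail` (crux stmt-CriticalPhenomena-4575), P3 lane: the Harris block for up-sets RELATIVE TO A GROUND SET, profile-wise —
# `Π_G·GF(F ∩ F') − GF(F)·GF(F') ∈ ℕ[s]` for families `F, F'` of subsets of `G` that are upward closed inside `2^G`

Support file (seat `prim-l12-p3`, gen 24; `--supports stmt-CriticalPhenomena-4575`).  Memo
`run/shared/lean/prim/prim-l12/FROM-prim-l12-p3-g24-VALUE-LEVEL-TH2K.md` §3 (Lean plan, item (1)).  Companion of `…SahiCTCHarrisBlock`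
(`coeff_harris`, DOWN-sets, ground set = the whole type).  The co-level-1 theorem of memo g24 §3 (CTC_{k−1}(k) for every `k`) splits the Harris form
of two up-sets along their common loops `L` and leaves a Harris block of two families living on the smaller ground set `V ∖ L`; this file supplies it.
Method: member-complementation INSIDE `G` (`S ↦ G ∖ S`, `coFamIn`) turns relative up-sets into (global) down-sets and reverses the profiles supported in
`G` (`n ↦ 2·1_G − n`, `rev2In`); the down-set block `coeff_harris` is then read backwards.
* `coeff_gf_mul_gf_coFamIn` : reversal of a two-factor coefficient inside `G`;
* **`coeff_harris_upIn`**, `coeff_harris_upIn_sub_nonneg` : the relative block for every profile (profiles not supported in `G`, or with an entry `> 2`,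
  carry no product of two members and are handled separately).
Nothing is asserted about the crux.
-/

namespace Summit.CriticalPhenomena.PercolationContinuityZ3.Theorems.SahiCTCForms

open Finset MvPolynomial SahiCTCGenFun

variable {α : Type*} [DecidableEq α] [Fintype α]

/-! ### Member-complementation inside a ground set -/

/-- The member-complement family inside `G`: `{G ∖ S : S ∈ F}`. [this work] -/
def coFamIn (G : Finset α) (F : Finset (Finset α)) : Finset (Finset α) := F.image fun S => G \ S

omit [Fintype α] in
/-- Membership in `coFamIn G F` for a family of subsets of `G`. [this work] -/
theorem mem_coFamIn {G : Finset α} {F : Finset (Finset α)} (hF : ∀ T ∈ F, T ⊆ G) {S : Finset α} :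
    S ∈ coFamIn G F ↔ S ⊆ G ∧ G \ S ∈ F := by
  unfold coFamIn
  constructor
  · intro h
    obtain ⟨T, hT, rfl⟩ := mem_image.1 h
    exact ⟨sdiff_subset, by rw [Finset.sdiff_sdiff_eq_self (hF T hT)]; exact hT⟩
  · rintro ⟨hS, h⟩
    exact mem_image.2 ⟨G \ S, h, Finset.sdiff_sdiff_eq_self hS⟩

omit [Fintype α] in
/-- Members of `coFamIn G F` are subsets of `G`. [this work] -/
theorem subset_of_mem_coFamIn {G : Finset α} {F : Finset (Finset α)} {S : Finset α} (h : S ∈ coFamIn G F) : S ⊆ G := by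
  unfold coFamIn at h
  obtain ⟨T, _, rfl⟩ := mem_image.1 h
  exact sdiff_subset

omit [Fintype α] in
/-- The member-complement (inside `G`) of a family upward closed inside `2^G` is a down-set. [this work] -/
theorem isLowerSet_coFamIn {G : Finset α} {F : Finset (Finset α)} (hF : ∀ T ∈ F, T ⊆ G)
    (hup : ∀ A ∈ F, ∀ B : Finset α, A ⊆ B → B ⊆ G → B ∈ F) : IsLowerSet ((coFamIn G F : Finset (Finset α)) : Set (Finset α)) := by
  intro S T hTS hS
  rw [Finset.mem_coe, mem_coFamIn hF] at hS ⊢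
  exact ⟨hTS.trans hS.1, hup _ hS.2 _ (sdiff_subset_sdiff Subset.rfl hTS) sdiff_subset⟩

omit [Fintype α] in
/-- Member-complementation inside `G` commutes with intersection. [this work] -/
theorem coFamIn_inter {G : Finset α} {F F' : Finset (Finset α)} (hF : ∀ T ∈ F, T ⊆ G) (hF' : ∀ T ∈ F', T ⊆ G) :
    coFamIn G (F ∩ F') = coFamIn G F ∩ coFamIn G F' := by
  have hFF' : ∀ T ∈ F ∩ F', T ⊆ G := fun T hT => hF T (mem_inter.1 hT).1
  ext S; simp only [mem_inter, mem_coFamIn hF, mem_coFamIn hF', mem_coFamIn hFF']; tauto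

omit [Fintype α] in
/-- The member-complement (inside `G`) of `2^G` is `2^G`. [this work] -/
theorem coFamIn_powerset (G : Finset α) : coFamIn G G.powerset = G.powerset := by
  have hP : ∀ T ∈ G.powerset, T ⊆ G := fun T hT => mem_powerset.1 hT
  ext S; simp only [mem_coFamIn hP, mem_powerset]
  constructor
  · rintro ⟨h, _⟩; exact h
  · intro h; exact ⟨h, sdiff_subset⟩

/-! ### Profile reversal inside a ground set -/

/-- The profile reversed inside `G`: `2·1_G − n` (truncated subtraction). [this work] -/
noncomputable def rev2In (G : Finset α) (n : α →₀ ℕ) : α →₀ ℕ := 2 • ind G - n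

omit [Fintype α] in
/-- `(2·1_G − n) i = 2 − n i` on `G` and `0` off `G`. [this work] -/
theorem rev2In_apply (G : Finset α) (n : α →₀ ℕ) (i : α) : rev2In G n i = if i ∈ G then 2 - n i else 0 := by
  unfold rev2In
  rw [Finsupp.tsub_apply, Finsupp.smul_apply, ind_apply]
  split_ifs <;> simp

omit [Fintype α] in
/-- Complementing both members inside `G` reverses the profile (for `n ≤ 2` supported in `G`, members inside `G`). [this work] -/
theorem ind_sdiff_add_ind_sdiff_eq_iff {G : Finset α} {n : α →₀ ℕ} (hn : ∀ i, n i ≤ 2) (hnG : ∀ i, i ∉ G → n i = 0) {P S : Finset α}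
    (hP : P ⊆ G) (hS : S ⊆ G) : ind (G \ P) + ind (G \ S) = rev2In G n ↔ ind P + ind S = n := by
  constructor
  · intro h
    ext i
    have hi := DFunLike.congr_fun h i
    rw [Finsupp.add_apply, ind_apply, ind_apply, rev2In_apply] at hi
    rw [Finsupp.add_apply, ind_apply, ind_apply]
    simp only [mem_sdiff] at hi
    have h2 := hn i
    by_cases hiG : i ∈ G
    · simp only [hiG, true_and, if_true] at hi
      split_ifs at hi ⊢ <;> omega
    · have h0 := hnG i hiG
      have hP' : i ∉ P := fun h => hiG (hP h)
      have hS' : i ∉ S := fun h => hiG (hS h)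
      simp [hP', hS', h0]
  · intro h
    ext i
    have hi := DFunLike.congr_fun h i
    rw [Finsupp.add_apply, ind_apply, ind_apply] at hi
    rw [Finsupp.add_apply, ind_apply, ind_apply, rev2In_apply]
    simp only [mem_sdiff]
    have h2 := hn i
    by_cases hiG : i ∈ G
    · simp only [hiG, true_and, if_true]
      split_ifs at hi ⊢ <;> omega
    · have hP' : i ∉ P := fun h => hiG (hP h)
      have hS' : i ∉ S := fun h => hiG (hS h)
      simp [hP', hS', hiG]

omit [Fintype α] in
/-- **Reversal of a two-factor coefficient inside `G`**: for families of subsets of `G` and a profile `n ≤ 2` supported in `G`,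
`coeff_{2·1_G−n}(GF(F̄)·GF(F̄')) = coeff_n(GF(F)·GF(F'))`. [this work] -/
theorem coeff_gf_mul_gf_coFamIn {G : Finset α} {F F' : Finset (Finset α)} (hF : ∀ T ∈ F, T ⊆ G) (hF' : ∀ T ∈ F', T ⊆ G)
    {n : α →₀ ℕ} (hn : ∀ i, n i ≤ 2) (hnG : ∀ i, i ∉ G → n i = 0) :
    (gf (coFamIn G F) * gf (coFamIn G F')).coeff (rev2In G n) = (gf F * gf F').coeff n := by
  rw [coeff_gf_mul_gf, coeff_gf_mul_gf]
  symm
  refine congrArg _ (card_bij' (fun PS _ => (G \ PS.1, G \ PS.2)) (fun PS _ => (G \ PS.1, G \ PS.2))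
    (fun PS hPS => ?_) (fun PS hPS => ?_) (fun PS hPS => ?_) (fun PS hPS => ?_))
  · obtain ⟨hmem, hsum⟩ := mem_filter.1 hPS
    obtain ⟨h1, h2⟩ := mem_product.1 hmem
    refine mem_filter.2 ⟨mem_product.2 ⟨?_, ?_⟩, (ind_sdiff_add_ind_sdiff_eq_iff hn hnG (hF _ h1) (hF' _ h2)).2 hsum⟩
    · exact (mem_coFamIn hF).2 ⟨sdiff_subset, by rw [Finset.sdiff_sdiff_eq_self (hF _ h1)]; exact h1⟩
    · exact (mem_coFamIn hF').2 ⟨sdiff_subset, by rw [Finset.sdiff_sdiff_eq_self (hF' _ h2)]; exact h2⟩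
  · obtain ⟨hmem, hsum⟩ := mem_filter.1 hPS
    obtain ⟨h1, h2⟩ := mem_product.1 hmem
    obtain ⟨hs1, hm1⟩ := (mem_coFamIn hF).1 h1
    obtain ⟨hs2, hm2⟩ := (mem_coFamIn hF').1 h2
    refine mem_filter.2 ⟨mem_product.2 ⟨hm1, hm2⟩, ?_⟩
    rw [← ind_sdiff_add_ind_sdiff_eq_iff hn hnG (sdiff_subset : G \ PS.1 ⊆ G) (sdiff_subset : G \ PS.2 ⊆ G),
      Finset.sdiff_sdiff_eq_self hs1, Finset.sdiff_sdiff_eq_self hs2]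
    exact hsum
  · obtain ⟨hmem, _⟩ := mem_filter.1 hPS
    obtain ⟨h1, h2⟩ := mem_product.1 hmem
    simp only [Finset.sdiff_sdiff_eq_self (hF _ h1), Finset.sdiff_sdiff_eq_self (hF' _ h2)]
  · obtain ⟨hmem, _⟩ := mem_filter.1 hPS
    obtain ⟨h1, h2⟩ := mem_product.1 hmem
    simp only [Finset.sdiff_sdiff_eq_self (subset_of_mem_coFamIn h1), Finset.sdiff_sdiff_eq_self (subset_of_mem_coFamIn h2)]

/-! ### The relative Harris block for up-sets -/

omit [Fintype α] in
/-- A product of two members of families inside `G` has a profile supported in `G`. [this work] -/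
theorem filter_prod_eq_empty_of_not_supported {G : Finset α} {F F' : Finset (Finset α)} (hF : ∀ T ∈ F, T ⊆ G) (hF' : ∀ T ∈ F', T ⊆ G)
    (n : α →₀ ℕ) (hnG : ¬ ∀ i, i ∉ G → n i = 0) : ((F ×ˢ F').filter fun PS => ind PS.1 + ind PS.2 = n) = ∅ := by
  obtain ⟨i, hi0⟩ := not_forall.mp hnG
  obtain ⟨hiG, hi⟩ := Classical.not_imp.mp hi0
  refine filter_eq_empty_iff.2 fun PS hPS h => ?_
  obtain ⟨h1, h2⟩ := mem_product.1 hPS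
  have hi' := DFunLike.congr_fun h i
  rw [Finsupp.add_apply, ind_apply, ind_apply] at hi'
  have hP : i ∉ PS.1 := fun h => hiG (hF _ h1 h)
  have hS : i ∉ PS.2 := fun h => hiG (hF' _ h2 h)
  rw [if_neg hP, if_neg hS] at hi'
  omega

/-- **The Harris block for up-sets RELATIVE TO A GROUND SET `G`**: if `F, F'` are families of subsets of `G`, upward closed inside `2^G`, then
every coefficient of `GF(F)·GF(F')` is at most the corresponding coefficient of `GF(2^G)·GF(F ∩ F')`. [this work] -/
theorem coeff_harris_upIn {G : Finset α} {F F' : Finset (Finset α)} (hF : ∀ T ∈ F, T ⊆ G) (hF' : ∀ T ∈ F', T ⊆ G)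
    (hupF : ∀ A ∈ F, ∀ B : Finset α, A ⊆ B → B ⊆ G → B ∈ F) (hupF' : ∀ A ∈ F', ∀ B : Finset α, A ⊆ B → B ⊆ G → B ∈ F')
    (n : α →₀ ℕ) : (gf F * gf F').coeff n ≤ (gf G.powerset * gf (F ∩ F')).coeff n := by
  have hRHS : 0 ≤ (gf G.powerset * gf (F ∩ F')).coeff n := by rw [coeff_gf_mul_gf]; exact_mod_cast Nat.zero_le _
  by_cases hn : ∀ i, n i ≤ 2
  swap
  · rw [coeff_gf_mul_gf, filter_prod_eq_empty _ _ n hn, card_empty]; exact_mod_cast hRHS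
  by_cases hnG : ∀ i, i ∉ G → n i = 0
  swap
  · rw [coeff_gf_mul_gf, filter_prod_eq_empty_of_not_supported hF hF' n hnG, card_empty]; exact_mod_cast hRHS
  have hFF' : ∀ T ∈ F ∩ F', T ⊆ G := fun T hT => hF T (mem_inter.1 hT).1
  have hP : ∀ T ∈ G.powerset, T ⊆ G := fun T hT => mem_powerset.1 hT
  have h := coeff_harris (isLowerSet_coFamIn hF hupF) (isLowerSet_coFamIn hF' hupF') (rev2In G n)
  rw [coeff_gf_mul_gf_coFamIn hF hF' hn hnG, ← coFamIn_inter hF hF'] at h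
  -- on the right, only subsets of `G` pair with members of the complemented family at the reversed profile
  have hset : ((univ.powerset ×ˢ coFamIn G (F ∩ F')).filter fun PS => ind PS.1 + ind PS.2 = rev2In G n) =
      ((G.powerset ×ˢ coFamIn G (F ∩ F')).filter fun PS => ind PS.1 + ind PS.2 = rev2In G n) := by
    ext PS
    simp only [mem_filter, mem_product, mem_powerset, subset_univ, true_and]
    constructor
    · rintro ⟨hK, hsum⟩
      refine ⟨⟨fun i hi => ?_, hK⟩, hsum⟩
      by_contra hiG
      have hi' := DFunLike.congr_fun hsum i
      rw [Finsupp.add_apply, ind_apply, ind_apply, rev2In_apply, if_pos hi, if_neg hiG] at hi'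
      omega
    · rintro ⟨⟨_, hK⟩, hsum⟩; exact ⟨hK, hsum⟩
  have hPi : (PiP * gf (coFamIn G (F ∩ F'))).coeff (rev2In G n) = (gf G.powerset * gf (coFamIn G (F ∩ F'))).coeff (rev2In G n) := by
    unfold PiP
    rw [coeff_gf_mul_gf, coeff_gf_mul_gf, hset]
  rw [hPi, ← coFamIn_powerset G, coeff_gf_mul_gf_coFamIn hP hFF' hn hnG] at h
  exact h

/-- `GF(2^G)·GF(F ∩ F') − GF(F)·GF(F') ∈ ℕ[s]` for families `F, F'` of subsets of `G` upward closed inside `2^G`. [this work] -/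
theorem coeff_harris_upIn_sub_nonneg {G : Finset α} {F F' : Finset (Finset α)} (hF : ∀ T ∈ F, T ⊆ G) (hF' : ∀ T ∈ F', T ⊆ G)
    (hupF : ∀ A ∈ F, ∀ B : Finset α, A ⊆ B → B ⊆ G → B ∈ F) (hupF' : ∀ A ∈ F', ∀ B : Finset α, A ⊆ B → B ⊆ G → B ∈ F')
    (n : α →₀ ℕ) : 0 ≤ (gf G.powerset * gf (F ∩ F') - gf F * gf F').coeff n := by
  rw [coeff_sub, sub_nonneg]; exact coeff_harris_upIn hF hF' hupF hupF' n

end Summit.CriticalPhenomena.PercolationContinuityZ3.Theorems.SahiCTCForms
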